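import Literature.IUT.LogThetaLattice.LatticeGlue
import Literature.IUT.LogThetaLattice.RadialDataCore
import Literature.IUT.LogThetaLattice.BiCoresCompat
import Literature.IUT.LogThetaLattice.FrobeniusPicture
import Literature.IUT.HodgeArakelov.ThetaGauLinks
import HarnessLib

/-!
# [IUTchIII] Corollary 2.3 (i)–(iv): discharge over the landed §1–§2 interfaces (proof-only companion)

Mochizuki, *Inter-universal Teichmüller Theory III*, kurims manuscript (May 2020), §2, Corollary 2.3,
pp. 72–75 [cite: Mochizuki2012, III Cor 2.3 pp.72–75] (D-0012 claim key, status disputed). DAG nodes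
`IUTchIII:Cor2.3(i)`, `IUTchIII:Cor2.3(ii)`, `IUTchIII:Cor2.3(iii)`, `IUTchIII:Cor2.3(iv)` (abc-iut cell,
DISCHARGE-L6 v1.5 §F row F8; sub-DAG `plan/L6/SUBDAG-IUTchIII-Cor-23.md` rows r1–r18). PROOF-ONLY companion
of `RadialData` (p406648), `RadialDataCore`, `ThetaMonoids` (p405523), `BiCores` (p406839) / `BiCoresCompat`,
`HodgeTheaterLogLink` (p406456), `LatticeGlue`, `FrobeniusPicture` (p403690): no definition, no new `Prop`,
nothing restated; every theorem below is a COMPOSITION of the landed interface data with the inputs the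
printed statement quotes. HONEST FRAMING: this is OUR kernel check that the printed assertions, AS TYPED over
the §1–§2 interfaces, follow from "the definitions and the references quoted" (printed proof, p. 75, one
sentence); it takes no side on [IUTchIII] Cor 3.12; typed ≠ endorsed.

PARAPHRASE of the printed statement (pp. 74–75 of the render `paper:url-4b091feeb646` p0074–p0075; word order kept,
NOTATION NORMALISED and displays elided «…» — NOT a byte-verbatim quotation, hence no quotation marks; abc-iut-L6-lead
§F v1.12 (1) quotation discipline): (i) The functor associated to the radial algorithm
defined above is full and essentially surjective. In particular, the radial environment defined above is
multiradial. (ii) Each `D-Θ^{±ell}NF`-Hodge theater `^{n,m}HT^{D-Θ±ell NF}`, for `n, m ∈ ℤ`, defines, in an evident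
way, an associated collection of radial data `^{n,m}ℜ`. The poly-isomorphisms induced by the vertical arrows of
the Gaussian log-theta-lattice under consideration [cf. Theorem 1.5, (i)] induce poly-isomorphisms of radial
data `… ⥲ ^{n,m}ℜ ⥲ ^{n,m+1}ℜ ⥲ …`. Write `^{n,∘}ℜ` for the collection of radial data obtained by identifying the
various `^{n,m}ℜ`, for `m ∈ ℤ`, via these poly-isomorphisms and `^{n,∘}ℭ` for the collection of coric data
associated, via the radial algorithm defined above, to the radial data `^{n,∘}ℜ`. In a similar vein, the
horizontal arrows of the Gaussian log-theta-lattice under consideration induce full poly-isomorphisms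
`… ⥲ ^{n,m}D^⊢_△ ⥲ ^{n+1,m}D^⊢_△ ⥲ …` of `D^⊢`-prime-strips [cf. Theorem 1.5, (ii)]. Write `^{∘,∘}ℭ` for the collection
of coric data obtained by identifying the various `^{n,∘}ℭ`, for `n ∈ ℤ`, via these poly-isomorphisms. Thus
… we obtain a diagram — i.e., an étale-picture of radial data — as in Fig. 2.4 … This diagram satisfies the
important property of admitting arbitrary permutation symmetries among the spokes [i.e., the labels
`n ∈ ℤ`] and is compatible, in the evident sense, with the étale-picture of `D-Θ^{±ell}NF`-Hodge theaters of
[IUTchII], Corollary 4.11, (ii). (iii) The [poly-]isomorphisms of `F^{⊢×μ}`-prime-strips of/induced by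
(e_ℜ), (b_{Morℜ}), (d_{Morℜ}) [cf. also (e_{Morℜ})] are compatible, relative to the Kummer isomorphisms of
Proposition 2.1, (ii) [cf. also Proposition 2.1, (vi)], and Theorem 1.5, (iii), with the poly-isomorphisms
— arising from the horizontal arrows of the Gaussian log-theta-lattice — of Theorem 1.5, (ii). (iv) The
algorithmic construction of the isomorphisms `F^⊩_{env}(†D_>) ⥲ F^⊩_{env}(‡D_>)`, `†ℜ^{bad} ⥲ ‡ℜ^{bad}` of (b_{Morℜ}),
(c_{Morℜ}), as well as of the Kummer isomorphisms and poly-isomorphisms of projective systems of mono-theta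
environments discussed in Proposition 2.1, (ii), (iii) [cf. also Proposition 2.1, (vi); the second display
of Theorem 2.2, (ii)], and Theorem 1.5, (iii), (v), are compatible [cf. the final portions of Theorems 1.5,
(v); 2.2, (ii)] with the horizontal arrows of the Gaussian log-theta-lattice [cf., e.g., the full
poly-isomorphisms of Theorem 1.5, (ii)], in the sense that these constructions are
stabilized/equivariant/functorial with respect to arbitrary automomorphisms of the domain and codomain of
these horizontal arrows of the Gaussian log-theta-lattice. [end of paraphrase]

## Census per sub-DAG row (PROVED = a theorem of this file; ALREADY = landed theorem cited by name;
## DATA = an interface field / functor, nothing to prove; SLOT = input not carried by the landed interface)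

* r1 (preamble, [IUTchII] Ex 1.7): ALREADY `thetaRadialEnvironment`; PROVED here the Ex 1.7 (iii)/(v)
  consequences for it (`cor23_ex17iii_diagonal`, `cor23_ex17v_lift`).
* r2 (preamble, Thm 2.2): DATA (`ThetaCoricData.rbad`, `ThetaMonoidData`).
* r8 (i): ALREADY `radialAlgorithm_full`, `radialAlgorithm_essSurj`, `thetaRadialEnvironment_isMultiradial`;
  assembled as `cor23_i`.
* r5 (ii) ← Thm 1.5 (i): PROVED `cor23ii_vertical_image_eq` (the vertical arrow of a `LogThetaLatticeDiagram`
  induces, through `Radial.Hom.ofDHT`, exactly `verticalRadialPolyIso`), `cor23ii_ofDHT_trans` (coherence of the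
  identifications defining `^{n,∘}ℜ`).
* r6 (ii) ← Thm 1.5 (ii): ALREADY `BiCoricData.kummerTransport_dv_full` (the horizontal arrow induces the FULL
  poly-isomorphism of `D^⊢_△`-prime-strips); PROVED `cor23ii_mem_horizontalCoricPolyIso_iff`,
  `cor23ii_horizontalCoric_conj_full` (every `D^⊢_△`-isomorphism gives a coric identification; the hub `^{∘,∘}ℭ`).
* r3 (ii) ← [IUTchII] Cor 4.11 (ii): PROVED `cor23ii_spoke_iso_nonempty`, `cor23ii_spokePerm_lattice`,
  `cor23ii_hub_conj_full` (arbitrary permutation symmetries among the spokes), `cor23ii_compatible_cor411ii`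
  (same étale-picture graph and spoke permutations as [IUTchII] Cor 4.11 (ii), `rfl`).
* r4 (ii) ← [IUTchII] Cor 4.5 (ii): DATA (`ThetaCoricData.fxmOfDv`, `Coric.coreFunctor`).
* r7 (ii) ← Thm 2.2 (ii): DATA (`ThetaCoricData.rbad`); functoriality PROVED `cor23iv_cMor_functorial`.
* r9–r12 (iii): ALREADY `ThetaMonoidData.cor23iii_full` ((e_ℜ) on the `ThetaMonoids` copy); PROVED over the glue
  `cor23iii_eR_horizontal` ((e_ℜ) vs Thm 1.5 (ii)+(iii) on `RadialData`'s objects), `cor23iii_dMor_mem_horizontal`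
  ((d_{Morℜ})), `cor23iii_bMor_kummerFgl`, `cor23iii_bMor_glue` ((b_{Morℜ}) vs the Kummer isomorphism of Prop 2.1 (ii)).
* r13–r18 (iv): PROVED `cor23iv_kummerΨ_equivariant`, `cor23iv_kummerΨInf_equivariant`, `cor23iv_kummerC_equivariant`,
  `cor23iv_kummerFgl_equivariant` (Prop 2.1 (ii)), `cor23iv_unitPortionD_equivariant` (Prop 2.1 (vi)),
  `cor23iv_kummer15iii_equivariant` (Thm 1.5 (iii)), `cor23iv_bMor_functorial`, `cor23iv_cMor_functorial`,
  `cor23iv_ofDHT_trans` ((b_{Morℜ}), (c_{Morℜ})), `cor23iv_horizontal_stabilized` (Thm 1.5 (ii)),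
  `cor23iv_realified_stabilized` (Thm 1.5 (v), `D^⊢`-side); ALREADY `ThetaMonoidData.cor23iv_equivariant`.
  SLOT (inputs the landed interfaces do not carry, reported, NOT assumed): the "poly-isomorphisms of projective
  systems of mono-theta environments" of Prop 2.1 (iii) and "the second display of Theorem 2.2, (ii)" have no
  field in `ThetaMonoidData` (owner abc-iut-L6-t3/t14, SUBDAG-IUTchIII-Prop-21/Thm-22); the `ℝ_{>0}`-orbit
  `BiCoricData.realifiedKummer` of Thm 1.5 (v) carries no functoriality law, so its equivariance is not derivable
  from `BiCores` as landed (owner abc-iut-L6-t3).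
-/

namespace Literature.IUT.LogThetaLattice

open CategoryTheory
open Literature.IUT.HodgeTheaters

universe u

variable {S : StripFrame.{u}}

/-! ### A poly-isomorphism lemma used for the "stabilized" clauses -/

/-- **IUTchI:§0** (kurims p.33) conjugating the functorial image of a FULL poly-isomorphism by functorially
induced automorphisms of its domain and codomain gives it back ("stabilized"). [claim: Mochizuki2012, status: disputed] -/
theorem _root_.Literature.IUT.HodgeTheaters.PolyIso.single_comp_map_full_comp_single
    {C : Type*} [Category C] {D : Type*} [Category D] (G : C ⥤ D) {X Y : C} (a : X ≅ X) (b : Y ≅ Y) :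
    ((PolyIso.single (G.mapIso a)).comp ((PolyIso.full X Y).map G)).comp (PolyIso.single (G.mapIso b)) =
      (PolyIso.full X Y).map G := by
  ext e
  constructor
  · rintro ⟨f, hf, g, hg, rfl⟩
    obtain ⟨q, hq, rfl⟩ := PolyIso.mem_single_comp.mp hf
    obtain ⟨x, -, rfl⟩ := PolyIso.mem_map.mp hq
    rw [PolyIso.mem_single] at hg
    subst hg
    exact PolyIso.mem_map.mpr ⟨a ≪≫ x ≪≫ b, PolyIso.mem_full _, by simp [Functor.mapIso_trans]⟩
  · intro he
    obtain ⟨x, -, rfl⟩ := PolyIso.mem_map.mp he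
    refine PolyIso.mem_comp_single.mpr ⟨G.mapIso a ≪≫ G.mapIso (a.symm ≪≫ x ≪≫ b.symm), ?_, ?_⟩
    · exact PolyIso.mem_single_comp.mpr ⟨G.mapIso (a.symm ≪≫ x ≪≫ b.symm),
        PolyIso.mem_map.mpr ⟨_, PolyIso.mem_full _, rfl⟩, rfl⟩
    · simp [Functor.mapIso_trans, Functor.mapIso_symm]

/-! ### Cor 2.3 (i) and the preamble: the radial environment is multiradial (sub-DAG rows r1, r8) -/

/-- **IUTchIII:Cor2.3(i)** (kurims p.74) "The functor associated to the radial algorithm defined above is full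
and essentially surjective. In particular, the radial environment defined above is multiradial." — the three
landed theorems of `RadialData` BY NAME (sub-DAG row r8: definitional unwinding only).
[claim: Mochizuki2012, status: disputed] -/
theorem cor23_i (E : ThetaCoricData S) [Nonempty S.DHT] :
    (radialAlgorithm E).Full ∧ (radialAlgorithm E).EssSurj ∧ (thetaRadialEnvironment E).IsMultiradial :=
  ⟨radialAlgorithm_full E, radialAlgorithm_essSurj E, thetaRadialEnvironment_isMultiradial E⟩

/-- **IUTchIII:Cor2.3(i)** (kurims p.74) with **IUTchII:Ex1.7(iii)** (sub-DAG row r1): for the radial environment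
of Cor 2.3, every object `(ℜ₁, ℜ₂, α : Φ(ℜ₁) ⥲ Φ(ℜ₂))` of `ℛ ×_𝒞 ℛ` is isomorphic to `(ℜ₁, ℜ₁, id)` — abc-iut-L6-t1's
PROVED characterisation of multiradiality `RadialEnvironment.multiradial_iff_iso_diagonal`, applied.
[claim: Mochizuki2012, status: disputed] -/
theorem cor23_ex17iii_diagonal (E : ThetaCoricData S) [Nonempty S.DHT]
    (X : (thetaRadialEnvironment E).FiberSquare) :
    Nonempty (X ≅ (thetaRadialEnvironment E).diagonal X.left) :=
  ((thetaRadialEnvironment E).multiradial_iff_iso_diagonal.mp (thetaRadialEnvironment_isMultiradial E)) X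

/-- **IUTchIII:Cor2.3(i)** (kurims p.74) with **IUTchII:Ex1.7(v)** (sub-DAG row r1): "one may lift gluing
isomorphisms in `𝒞` to gluing isomorphisms in `ℛ`" — every isomorphism of coric data `Φ(ℜ₁) ⥲ Φ(ℜ₂)` is the image
of an isomorphism of radial data `ℜ₁ ⥲ ℜ₂` (L6-t1's `RadialEnvironment.exists_lift_iso`, applied to Cor 2.3 (i)).
[claim: Mochizuki2012, status: disputed] -/
theorem cor23_ex17v_lift (E : ThetaCoricData S) [Nonempty S.DHT] {R₁ R₂ : Radial E}
    (β : (radialAlgorithm E).obj R₁ ≅ (radialAlgorithm E).obj R₂) :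
    ∃ f : R₁ ≅ R₂, (radialAlgorithm E).mapIso f = β :=
  (thetaRadialEnvironment E).exists_lift_iso (thetaRadialEnvironment_isMultiradial E) β

/-! ### Cor 2.3 (ii): the étale-picture of radial data (sub-DAG rows r3–r7) -/

/-- **IUTchIII:Cor2.3(ii)** (kurims p.74) ← **Thm 1.5 (i)** (sub-DAG row r5): "The poly-isomorphisms induced by
the vertical arrows of the Gaussian log-theta-lattice under consideration [cf. Theorem 1.5, (i)] induce
poly-isomorphisms of radial data `… ⥲ ^{n,m}ℜ ⥲ ^{n,m+1}ℜ ⥲ …`": for an actual log-theta-lattice `Λ` (Def 1.4,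
`LogThetaLatticeDiagram`, either kind) the poly-isomorphism of `D`-Hodge theaters induced by the vertical arrow
`(n,m) → (n,m+1)` (FULL, `vertical_inducedDHT_full` = Thm 1.5 (i)), pushed through `ξ ↦ (ξ, F^{⊢×μ}_△(D^⊢_△(ξ)))`
(`Radial.Hom.ofDHT`), IS `RadialData`'s `verticalRadialPolyIso`. [claim: Mochizuki2012, status: disputed] -/
theorem cor23ii_vertical_image_eq (E : ThetaCoricData S) {L : LogStripData S} {T : ThetaLinkData S}
    (Λ : LogThetaLatticeDiagram L T) (n m : ℤ) :
    (fun ξ => Radial.Hom.ofDHT (E := E)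
        (R := latticeRadial E (fun p => S.htToD.obj (Λ.HT p)) (n, m))
        (R' := latticeRadial E (fun p => S.htToD.obj (Λ.HT p)) (n, m + 1)) ξ) ''
      (Λ.vertical n m).inducedDHT =
    verticalRadialPolyIso E (fun p => S.htToD.obj (Λ.HT p)) n m := by
  rw [Λ.vertical_inducedDHT_full, verticalRadialPolyIso, PolyIso.full]
  exact Set.image_univ

/-- **IUTchIII:Cor2.3(ii)** (kurims p.74) (sub-DAG row r5) "Write `^{n,∘}ℜ` for the collection of radial data
obtained by identifying the various `^{n,m}ℜ`, for `m ∈ ℤ`, via these poly-isomorphisms": the identifications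
are coherent — the morphism of radial data induced by a composite of isomorphisms of `D`-Hodge theaters is the
composite of the induced morphisms (so the `^{n,m}ℜ`, `m ∈ ℤ`, with all induced morphisms form ONE connected
system; cf. `Radial.coreFunctor`). [claim: Mochizuki2012, status: disputed] -/
theorem cor23ii_ofDHT_trans (E : ThetaCoricData S) {R R' R'' : Radial E} (ξ : R.ht ≅ R'.ht)
    (ξ' : R'.ht ≅ R''.ht) :
    Radial.Hom.ofDHT (E := E) (ξ ≪≫ ξ') = Radial.Hom.ofDHT ξ ≫ Radial.Hom.ofDHT ξ' := by
  apply Radial.hom_ext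
  · rfl
  · simp only [Radial.Hom.ofDHT, Radial.comp_δ, Functor.mapIso_trans]

/-- **IUTchIII:Cor2.3(ii)** (kurims p.74) ← **Thm 1.5 (ii)** (sub-DAG row r6): "the horizontal arrows …
induce full poly-isomorphisms `… ⥲ ^{n,m}D^⊢_△ ⥲ ^{n+1,m}D^⊢_△ ⥲ …` of `D^⊢`-prime-strips [cf. Theorem 1.5, (ii)]" —
BY NAME: Thm 1.5 (ii)'s FULL poly-isomorphism of `F^{⊢×μ}_△`-prime-strips, transported along the Kummer
isomorphisms of Thm 1.5 (iii), induces the FULL poly-isomorphism of `D^⊢_△`-prime-strips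
(`BiCoricData.kummerTransport_dv_full`, landed in `BiCoresCompat`). [claim: Mochizuki2012, status: disputed] -/
theorem cor23ii_horizontal_dv_full (B : BiCoricData S) (X Y : S.HT) :
    B.dvConj '' (B.kummerTransport '' PolyIso.full (B.fxmDeltaHT.obj X) (B.fxmDeltaHT.obj Y)) =
      PolyIso.full (B.dvDeltaOf (S.htToD.obj X)) (B.dvDeltaOf (S.htToD.obj Y)) :=
  B.kummerTransport_dv_full X Y

/-- **IUTchIII:Cor2.3(ii)** (kurims p.74) (sub-DAG row r6) "Write `^{∘,∘}ℭ` for the collection of coric data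
obtained by identifying the various `^{n,∘}ℭ` … via these poly-isomorphisms": a morphism of coric data between
`Φ(^{n,m}ℜ)` and `Φ(^{n+1,m}ℜ)` belongs to the identifying poly-isomorphism `horizontalCoricPolyIso` iff it is the
one INDUCED by its underlying isomorphism of `D^⊢_△`-prime-strips, `(d, F^{⊢×μ}(d))` — so, the induced
`D^⊢_△`-poly-isomorphism being full (`cor23ii_horizontal_dv_full`), EVERY `D^⊢_△`-isomorphism contributes.
[claim: Mochizuki2012, status: disputed] -/
theorem cor23ii_mem_horizontalCoricPolyIso_iff (E : ThetaCoricData S) (H : ℤ × ℤ → S.DHT) (n m : ℤ)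
    (f : (radialAlgorithm E).obj (latticeRadial E H (n, m)) ⟶
      (radialAlgorithm E).obj (latticeRadial E H (n + 1, m))) :
    f ∈ horizontalCoricPolyIso E H n m ↔ f.δ = E.fxmOfDv.mapIso f.d := by
  constructor
  · rintro ⟨d, rfl⟩
    rfl
  · intro hf
    refine ⟨f.d, Coric.hom_ext rfl ?_⟩
    exact hf.symm

/-- **IUTchIII:Cor2.3(ii)** (kurims p.74) (sub-DAG row r6) the hub `F^{⊢×μ}_△(^{∘,∘}D^⊢_△)` of Fig. 2.4: between the
coric data of ANY two spokes/lattice points there is an induced identification (the `D^⊢`-prime-strips being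
mutually isomorphic), and conjugating the FULL coric poly-isomorphism by induced identifications gives the full
one — the identifications defining `^{∘,∘}ℭ` are mutually compatible. READING NOTE (abc-iut-L6-t22, F8-N1): `PolyIso.full`
here is the set of ALL coric isomorphisms, COARSER than print's «these poly-isomorphisms» = the identifications INDUCED
by the full poly-isomorphism of `D^⊢_△`-prime-strips (`cor23ii_mem_horizontalCoricPolyIso_iff`; the precise induced
class is abc-iut-L6-t22's `ThetaCoricData.coricPolyIso` / `etalePictureCoric_eq` in `EtalePictureChainProofs.lean`);
the statement holds a fortiori for the coarser class. [claim: Mochizuki2012, status: disputed] -/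
theorem cor23ii_horizontalCoric_conj_full (E : ThetaCoricData S) {C₁ C₁' C₂ C₂' : Coric E}
    (φ : C₁' ≅ C₁) (ψ : C₂ ≅ C₂') :
    Nonempty (C₁ ≅ C₂) ∧
      ((PolyIso.single φ).comp (PolyIso.full C₁ C₂)).comp (PolyIso.single ψ) = PolyIso.full C₁' C₂' := by
  refine ⟨?_, ?_⟩
  · obtain ⟨d⟩ := E.iso_nonempty_Dv C₁.dv C₂.dv
    exact ⟨(Groupoid.isoEquivHom C₁ C₂).symm ⟨d, E.fxmOfDv.mapIso d, E.mapIso_fxmOfDv_dv d⟩⟩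
  · rw [PolyIso.comp_full_of_nonempty (P := PolyIso.single φ) ⟨φ, rfl⟩,
      PolyIso.full_comp_of_nonempty (Q := PolyIso.single ψ) ⟨ψ, rfl⟩]

/-- **IUTchIII:Cor2.3(ii)** (kurims p.74) ← **[IUTchII] Cor 4.11 (ii)** (sub-DAG row r3): any two collections of
radial data are isomorphic (all `D-Θ^{±ell}NF`-Hodge theaters being isomorphic [IUTchI, Rmk 6.12.2 (ii)], and `ℛ`
being a groupoid) — the isomorphisms that permute the spokes. [claim: Mochizuki2012, status: disputed] -/
theorem cor23ii_spoke_iso_nonempty (E : ThetaCoricData S) (R R' : Radial E) : Nonempty (R ≅ R') :=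
  ⟨(Groupoid.isoEquivHom R R').symm (Radial.Hom.ofDHT (S.iso_nonempty_DHT R.ht R'.ht).some)⟩

/-- **IUTchIII:Cor2.3(ii)** (kurims p.74) (sub-DAG row r3) "This diagram satisfies the important property of
admitting arbitrary permutation symmetries among the spokes [i.e., the labels `n ∈ ℤ`]": for EVERY permutation
`σ` of `ℤ`, the radial data of the spoke `n` and of the spoke `σ n` are isomorphic (at every `m`), and (hub side,
`cor23ii_hub_conj_full`) the gluings to the core are carried to gluings. [claim: Mochizuki2012, status: disputed] -/
theorem cor23ii_spokePerm_lattice (E : ThetaCoricData S) (H : ℤ × ℤ → S.DHT) (σ : Equiv.Perm ℤ)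
    (n m m' : ℤ) : Nonempty (latticeRadial E H (n, m) ≅ latticeRadial E H (σ n, m')) :=
  cor23ii_spoke_iso_nonempty E _ _

/-- **IUTchIII:Cor2.3(ii)** (kurims p.74) (sub-DAG row r3) hub side of the spoke permutations: transporting the
(full) gluing `Φ(^{n,∘}ℜ) ⥲ F^{⊢×μ}_△(^{∘,∘}D^⊢_△)` of a spoke along the images `Φ(φ)`, `Φ(ψ)` of isomorphisms of radial
data gives the (full) gluing of the permuted spoke — the étale-picture is carried to itself (all coric
isomorphisms — coarser than the induced class, cf. `EtalePictureChainProofs.etalePictureCoric_relabel`, F8-N1).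
[claim: Mochizuki2012, status: disputed] -/
theorem cor23ii_hub_conj_full (E : ThetaCoricData S) {R₁ R₁' R₂ R₂' : Radial E} (φ : R₁' ≅ R₁)
    (ψ : R₂ ≅ R₂') :
    ((PolyIso.single ((radialAlgorithm E).mapIso φ)).comp
        (PolyIso.full ((radialAlgorithm E).obj R₁) ((radialAlgorithm E).obj R₂))).comp
      (PolyIso.single ((radialAlgorithm E).mapIso ψ)) =
    PolyIso.full ((radialAlgorithm E).obj R₁') ((radialAlgorithm E).obj R₂') :=
  (cor23ii_horizontalCoric_conj_full E ((radialAlgorithm E).mapIso φ) ((radialAlgorithm E).mapIso ψ)).2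

/-- **IUTchIII:Cor2.3(ii)** (kurims p.74) (sub-DAG row r3) "compatible, in the evident sense, with the
étale-picture of `D-Θ^{±ell}NF`-Hodge theaters of [IUTchII], Corollary 4.11, (ii)": the étale-picture of radial
data (`etalePicture ℤ`, Fig. 2.4) and abc-iut-L6-t2's étale-picture of [IUTchII] Cor 4.11 (ii) (Fig. 4.3) are the
SAME star graph on the spokes `n ∈ ℤ`, with the SAME spoke-permutation automorphisms; and the radial algorithm
factors through `†HT^D ↦ †D^⊢_△` (`Radial.coreFunctorRadialAlgorithmIso`, landed). [claim: Mochizuki2012, status: disputed] -/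
theorem cor23ii_compatible_cor411ii (σ : Equiv.Perm ℤ) :
    Literature.IUT.HodgeArakelov.cor411ii_spokePerm σ = etalePicture.spokePerm σ ∧
      ∀ n : ℤ, etalePicture.spokePerm σ (some n) = some (σ n) ∧
        etalePicture.spokePerm σ (none : Option ℤ) = none :=
  ⟨rfl, fun n => ⟨etalePicture.spokePerm_some σ n, etalePicture.spokePerm_none σ⟩⟩

/-! ### Cor 2.3 (iii): compatibility with the horizontal arrows, relative to the Kummer isomorphisms (rows r9–r12) -/

/-- **IUTchIII:Cor2.3(iii)** (kurims p.75) (e_ℜ) (sub-DAG rows r9–r12), over ONE set of §1–§2 objects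
(`LatticeGlue`): the full poly-isomorphism (e_ℜ) `F^{⊢×μ}_{env}(†D_>) ⥲ F^{⊢×μ}_△(†D^⊢_△)` at the domain `†HT = X` of a
horizontal arrow, followed — RELATIVE TO the Kummer isomorphism `^XF^{⊢×μ}_△ ⥲ F^{⊢×μ}_△(^XD^⊢_△)` of Thm 1.5 (iii)
(`LatticeGlue.kummerT`, on `RadialData`'s copy via `fxmDeltaE_iso`) — by the poly-isomorphism
`^XF^{⊢×μ}_△ ⥲ ^YF^{⊢×μ}_△` induced by the horizontal arrow (FULL: Thm 1.5 (ii), `ThetaLinkData.linkInducedFxm_full`)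
and the Kummer isomorphism at the codomain `Y`, is the full poly-isomorphism `F^{⊢×μ}_{env}(^XD_>) ⥲ F^{⊢×μ}_△(^YD^⊢_△)`:
(e_ℜ) is compatible with the horizontal arrows. [claim: Mochizuki2012, status: disputed] -/
theorem cor23iii_eR_horizontal (G : LatticeGlue S) (k : LatticeKind) (X Y : S.HT) :
    (((Radial.envToDelta (E := G.coric) ⟨S.htToD.obj X⟩).comp
        (PolyIso.single ((G.fxmDeltaE_iso.app (S.htToD.obj X)) ≪≫ (G.kummerT.app X).symm))).comp
      (G.linkData.linkInducedFxm k X Y)).comp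
      (PolyIso.single ((G.kummerT.app Y) ≪≫ (G.fxmDeltaE_iso.app (S.htToD.obj Y)).symm)) =
    PolyIso.full _ _ := by
  rw [Radial.envToDelta, PolyIso.full_comp_of_nonempty (Q := PolyIso.single _) ⟨_, rfl⟩,
    G.linkData.linkInducedFxm_full,
    PolyIso.full_comp_of_nonempty (Q := PolyIso.full _ _) ⟨(S.iso_nonempty_Fxm _ _).some, PolyIso.mem_full _⟩,
    PolyIso.full_comp_of_nonempty (Q := PolyIso.single _) ⟨_, rfl⟩]

/-- **IUTchIII:Cor2.3(iii)** (kurims p.75) (d_{Morℜ}) (sub-DAG rows r11, r12): any isomorphism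
`F^{⊢×μ}_△(^XD^⊢_△) ⥲ F^{⊢×μ}_△(^YD^⊢_△)` (the (d_{Morℜ})-component of a morphism of radial data), read through the Kummer
isomorphisms of Thm 1.5 (iii) at `X` and `Y`, is a constituent of the poly-isomorphism `^XF^{⊢×μ}_△ ⥲ ^YF^{⊢×μ}_△`
induced by the horizontal arrow — because that poly-isomorphism is FULL (Thm 1.5 (ii)).
[claim: Mochizuki2012, status: disputed] -/
theorem cor23iii_dMor_mem_horizontal (G : LatticeGlue S) (k : LatticeKind) {X Y : S.HT}
    (δ : G.coric.fxmDelta.obj (S.htToD.obj X) ≅ G.coric.fxmDelta.obj (S.htToD.obj Y)) :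
    ((G.kummerT.app X) ≪≫ (G.fxmDeltaE_iso.app (S.htToD.obj X)).symm) ≪≫ δ ≪≫
        ((G.fxmDeltaE_iso.app (S.htToD.obj Y)) ≪≫ (G.kummerT.app Y).symm) ∈
      G.linkData.linkInducedFxm k X Y := by
  rw [G.linkData.linkInducedFxm_full]
  exact PolyIso.mem_full _

/-- **IUTchIII:Cor2.3(iii)** (kurims p.75) (b_{Morℜ}) "relative to the Kummer isomorphisms of Proposition 2.1,
(ii)" (sub-DAG row r9): for an isomorphism of Hodge theaters `Ξ : X ⥲ Y`, the Frobenius-like isomorphism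
`^XF^⊩_{env} ⥲ ^YF^⊩_{env}` and the étale-like (b_{Morℜ}) isomorphism `F^⊩_{env}(^XD_>) ⥲ F^⊩_{env}(^YD_>)` induced by `D(Ξ)`
correspond under the Kummer isomorphisms `†F^⊩_{env} ⥲ F^⊩_{env}(†D_>)` (naturality of `ThetaMonoidData.kummerFgl`).
[claim: Mochizuki2012, status: disputed] -/
theorem cor23iii_bMor_kummerFgl (T : ThetaMonoidData S) {X Y : S.HT} (Ξ : X ≅ Y) :
    T.FglEnvHT.mapIso Ξ ≪≫ T.kummerFglAt Y =
      T.kummerFglAt X ≪≫ T.FglEnvD.mapIso (T.Dgt.mapIso (S.htToD.mapIso Ξ)) :=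
  Iso.ext (T.kummerFgl.hom.naturality Ξ.hom)

/-- **IUTchIII:Cor2.3(iii)** (kurims p.75) (b_{Morℜ}) on `RadialData`'s objects (sub-DAG row r9): the isomorphism
`F^⊩_{env}(†D_>) ⥲ F^⊩_{env}(‡D_>)` induced (`Radial.Hom.fglEnvIso`) by the morphism of radial data `(ξ, F^{⊢×μ}_△(D^⊢_△(ξ)))`
agrees, under the glue identification `LatticeGlue.fglEnv_iso` with Prop 2.1 (ii)'s `F^⊩_{env}(†D_>)`, with the
isomorphism Prop 2.1's functorial algorithm assigns to `ξ`. [claim: Mochizuki2012, status: disputed] -/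
theorem cor23iii_bMor_glue (G : LatticeGlue S) {H H' : S.DHT} (ξ : H ≅ H') :
    Radial.Hom.fglEnvIso (Radial.Hom.ofDHT (E := G.coric) (R := ⟨H⟩) (R' := ⟨H'⟩) ξ) ≪≫
        G.fglEnv_iso.app H' =
      G.fglEnv_iso.app H ≪≫ (S.dstrip G.thetaMonoid.gt ⋙ G.thetaMonoid.FglEnvD).mapIso ξ :=
  Iso.ext (G.fglEnv_iso.hom.naturality ξ.hom)

/-! ### Cor 2.3 (iv): stabilized / equivariant / functorial (sub-DAG rows r13–r18) -/

/-- **IUTchIII:Cor2.3(iv)** (kurims p.75) ← **Prop 2.1 (ii)** (sub-DAG row r13): the Kummer isomorphism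
`Ψ_{F_{env}}(†HT^Θ) ⥲ Ψ_{env}(†D_>)` is EQUIVARIANT: it carries the automorphism of `Ψ_{F_{env}}(†HT^Θ)` induced by an
automorphism (indeed any isomorphism) `α` of the Hodge theater to the automorphism of `Ψ_{env}(†D_>)` induced by
`D_>(α)`. [claim: Mochizuki2012, status: disputed] -/
theorem cor23iv_kummerΨ_equivariant (T : ThetaMonoidData S) {X Y : S.HT} (α : X ≅ Y) :
    (T.kummerΨAt X).symm ≪≫ T.ΨFenv.mapIso α ≪≫ T.kummerΨAt Y =
      T.ΨenvD.mapIso (T.Dgt.mapIso (S.htToD.mapIso α)) :=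
  Iso.ext (NatIso.naturality_1 T.kummerΨ α.hom)

/-- **IUTchIII:Cor2.3(iv)** (kurims p.75) ← **Prop 2.1 (ii)** (sub-DAG row r13): the same for
`_∞Ψ_{F_{env}}(†HT^Θ) ⥲ _∞Ψ_{env}(†D_>)`. [claim: Mochizuki2012, status: disputed] -/
theorem cor23iv_kummerΨInf_equivariant (T : ThetaMonoidData S) {X Y : S.HT} (α : X ≅ Y) :
    (T.kummerΨInf.app X).symm ≪≫ T.ΨFenvInf.mapIso α ≪≫ T.kummerΨInf.app Y =
      T.ΨenvInfD.mapIso (T.Dgt.mapIso (S.htToD.mapIso α)) :=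
  Iso.ext (NatIso.naturality_1 T.kummerΨInf α.hom)

/-- **IUTchIII:Cor2.3(iv)** (kurims p.75) ← **Prop 2.1 (ii)** (sub-DAG row r13): the same for the global realified
Kummer isomorphism `C^⊩_{env}(†HT^Θ) ⥲ D^⊩_{env}(†D^⊢_>)`. [claim: Mochizuki2012, status: disputed] -/
theorem cor23iv_kummerC_equivariant (T : ThetaMonoidData S) {X Y : S.HT} (α : X ≅ Y) :
    (T.kummerCAt X).symm ≪≫ T.CglEnv.mapIso α ≪≫ T.kummerCAt Y =
      T.DglEnv.mapIso (S.DToDv.mapIso (T.Dgt.mapIso (S.htToD.mapIso α))) :=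
  Iso.ext (NatIso.naturality_1 T.kummerC α.hom)

/-- **IUTchIII:Cor2.3(iv)** (kurims p.75) ← **Prop 2.1 (ii)**, last display (sub-DAG row r13): the same for
`†F^⊩_{env} ⥲ F^⊩_{env}(†D_>)`. [claim: Mochizuki2012, status: disputed] -/
theorem cor23iv_kummerFgl_equivariant (T : ThetaMonoidData S) {X Y : S.HT} (α : X ≅ Y) :
    (T.kummerFglAt X).symm ≪≫ T.FglEnvHT.mapIso α ≪≫ T.kummerFglAt Y =
      T.FglEnvD.mapIso (T.Dgt.mapIso (S.htToD.mapIso α)) :=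
  Iso.ext (NatIso.naturality_1 T.kummerFgl α.hom)

/-- **IUTchIII:Cor2.3(iv)** (kurims p.75) ← **Prop 2.1 (vi)** (sub-DAG row r14): the natural isomorphism
`F^{⊢×μ}_△(†D^⊢_△) ⥲ F^{⊢×μ}_{env}(†D_>)` is equivariant for the automorphisms induced by any isomorphism `ξ` of `D`-Hodge
theaters. [claim: Mochizuki2012, status: disputed] -/
theorem cor23iv_unitPortionD_equivariant (T : ThetaMonoidData S) {H H' : S.DHT} (ξ : H ≅ H') :
    (T.unitPortionD.app H).symm ≪≫ T.fxmDeltaD.mapIso ξ ≪≫ T.unitPortionD.app H' =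
      (S.dstrip T.gt ⋙ T.FglEnvD ⋙ S.FglToFglxm ⋙ S.FglxmToFxm).mapIso ξ :=
  Iso.ext (NatIso.naturality_1 T.unitPortionD ξ.hom)

/-- **IUTchIII:Cor2.3(iv)** (kurims p.75) ← **Thm 1.5 (iii)** (sub-DAG rows r15, r16): the Kummer isomorphism
`^{n,m}F^{⊢×μ}_△ ⥲ F^{⊢×μ}_△(^{n,m}D^⊢_△)` is equivariant: it carries the automorphism of `†F^{⊢×μ}_△` induced by an
automorphism `α` of `†HT` (the domain or the codomain of a horizontal arrow) to `F^{⊢×μ}_△(D^⊢_△(D(α)))`.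
[claim: Mochizuki2012, status: disputed] -/
theorem cor23iv_kummer15iii_equivariant (B : BiCoricData S) {X Y : S.HT} (α : X ≅ Y) :
    (B.kummerAt X).symm ≪≫ B.fxmDeltaHT.mapIso α ≪≫ B.kummerAt Y =
      B.fxmOfDv.mapIso (B.dvDelta.mapIso (S.htToD.mapIso α)) :=
  Iso.ext (NatIso.naturality_1 B.kummer α.hom)

/-- **IUTchIII:Cor2.3(iv)** (kurims p.75) (b_{Morℜ}) (sub-DAG row r13) "the algorithmic construction of the
isomorphisms `F^⊩_{env}(†D_>) ⥲ F^⊩_{env}(‡D_>)` … [is] functorial": composites go to composites.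
[claim: Mochizuki2012, status: disputed] -/
theorem cor23iv_bMor_functorial (E : ThetaCoricData S) {R R' R'' : Radial E} (f : R ⟶ R') (g : R' ⟶ R'') :
    Radial.Hom.fglEnvIso (f ≫ g) = Radial.Hom.fglEnvIso f ≪≫ Radial.Hom.fglEnvIso g :=
  E.fglEnv.mapIso_trans f.ξ g.ξ

/-- **IUTchIII:Cor2.3(iv)** (kurims p.75) (c_{Morℜ}) ← **Thm 2.2 (ii)** (sub-DAG rows r7, r17) "… `†ℜ^{bad} ⥲ ‡ℜ^{bad}`
of (c_{Morℜ}) … functorial": composites go to composites. [claim: Mochizuki2012, status: disputed] -/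
theorem cor23iv_cMor_functorial (E : ThetaCoricData S) {R R' R'' : Radial E} (f : R ⟶ R') (g : R' ⟶ R'') :
    Radial.Hom.rbadIso (f ≫ g) = Radial.Hom.rbadIso f ≪≫ Radial.Hom.rbadIso g :=
  E.rbad.mapIso_trans f.ξ g.ξ

/-- **IUTchIII:Cor2.3(iv)** (kurims p.75) (sub-DAG row r13) "with respect to arbitrary automorphisms of the
domain and codomain of these horizontal arrows": an automorphism `α` of `^{n,m}HT` acts on the radial data through
`D(α)` (`Radial.Hom.ofDHT`), multiplicatively — so (b_{Morℜ}), (c_{Morℜ}) are EQUIVARIANT for `Aut(^{n,m}HT)` by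
`cor23iv_bMor_functorial` / `cor23iv_cMor_functorial`. [claim: Mochizuki2012, status: disputed] -/
theorem cor23iv_ofDHT_trans (E : ThetaCoricData S) (R : Radial E) {X : S.HT} (hX : S.htToD.obj X = R.ht)
    (α β : X ≅ X) :
    Radial.Hom.ofDHT (E := E) (R := R) (R' := R)
        (eqToIso hX.symm ≪≫ S.htToD.mapIso (α ≪≫ β) ≪≫ eqToIso hX) =
      Radial.Hom.ofDHT (eqToIso hX.symm ≪≫ S.htToD.mapIso α ≪≫ eqToIso hX) ≫
        Radial.Hom.ofDHT (eqToIso hX.symm ≪≫ S.htToD.mapIso β ≪≫ eqToIso hX) := by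
  rw [← cor23ii_ofDHT_trans]
  congr 1
  ext
  simp

/-- **IUTchIII:Cor2.3(iv)** (kurims p.75) ← **Thm 1.5 (ii)** (sub-DAG rows r15, r18) "stabilized … with respect
to arbitrary automorphisms of the domain and codomain of these horizontal arrows": the poly-isomorphism
`^XF^{⊢×μ}_△ ⥲ ^YF^{⊢×μ}_△` induced by a horizontal arrow `X → Y` (FULL, Thm 1.5 (ii)) is carried to itself by the
automorphisms induced by any `α ∈ Aut(X)`, `β ∈ Aut(Y)`. [claim: Mochizuki2012, status: disputed] -/
theorem cor23iv_horizontal_stabilized (T : ThetaLinkData S) (k : LatticeKind) {X Y : S.HT} (α : X ≅ X)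
    (β : Y ≅ Y) :
    ((PolyIso.single (T.fxmDelta.mapIso α)).comp (T.linkInducedFxm k X Y)).comp
        (PolyIso.single (T.fxmDelta.mapIso β)) =
      T.linkInducedFxm k X Y := by
  rw [T.linkInducedFxm_full, PolyIso.comp_full_of_nonempty (P := PolyIso.single _) ⟨_, rfl⟩,
    PolyIso.full_comp_of_nonempty (Q := PolyIso.single _) ⟨_, rfl⟩]

/-- **IUTchIII:Cor2.3(iv)** (kurims p.75) ← **Thm 1.5 (v)** (sub-DAG rows r16, r18), `D^⊢`-side: the
poly-isomorphism `(D^⊩(^XD^⊢_△), …) ⥲ (D^⊩(^YD^⊢_△), …)` induced by the bi-coricity poly-isomorphisms of `D^⊢`-prime-strips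
(`BiCoricData.biCoricRealifiedPolyIso`) is STABILIZED by the automorphisms induced by arbitrary automorphisms
of the `D^⊢_△`-prime-strips at both ends (hence by those induced by `Aut(^{n,m}HT)`, `Aut(^{n+1,m}HT)`). The
`ℝ_{>0}`-orbit part of Thm 1.5 (v) (`realifiedKummer`) carries no functoriality law in `BiCores` — SLOT, see the
module docstring. [claim: Mochizuki2012, status: disputed] -/
theorem cor23iv_realified_stabilized (B : BiCoricData S) {H H' : S.DHT} (d : B.dvDeltaOf H ≅ B.dvDeltaOf H)
    (d' : B.dvDeltaOf H' ≅ B.dvDeltaOf H') :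
    ((PolyIso.single (B.realified.mapIso d)).comp (B.biCoricRealifiedPolyIso H H')).comp
        (PolyIso.single (B.realified.mapIso d')) =
      B.biCoricRealifiedPolyIso H H' :=
  PolyIso.single_comp_map_full_comp_single B.realified d d'

/-- **IUTchIII:Cor2.3(iv)** (kurims p.75) ← **Thm 1.5 (iii)** (sub-DAG row r15), `D^⊢`-side: likewise the
HORIZONTAL poly-isomorphism `F^{⊢×μ}_△(^XD^⊢_△) ⥲ F^{⊢×μ}_△(^YD^⊢_△)` of Thm 1.5 (iii) (`BiCoricData.horizontalPolyIso`, induced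
through `F^{⊢×μ}_△(−)` by the full poly-isomorphism of `D^⊢_△`-prime-strips) is stabilized by the automorphisms induced
by arbitrary automorphisms of the `D^⊢_△`-prime-strips. [claim: Mochizuki2012, status: disputed] -/
theorem cor23iv_horizontal15iii_stabilized (B : BiCoricData S) {H H' : S.DHT}
    (d : B.dvDeltaOf H ≅ B.dvDeltaOf H) (d' : B.dvDeltaOf H' ≅ B.dvDeltaOf H') :
    ((PolyIso.single (B.fxmOfDv.mapIso d)).comp (B.horizontalPolyIso H H')).comp
        (PolyIso.single (B.fxmOfDv.mapIso d')) =
      B.horizontalPolyIso H H' :=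
  PolyIso.single_comp_map_full_comp_single B.fxmOfDv d d'

end Literature.IUT.LogThetaLattice
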